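import Literature.MathematicalPhysics.QuantumFieldTheory.Balaban1983to89.B15Claim196T0
import Literature.MathematicalPhysics.QuantumFieldTheory.Balaban1983to89.B15TreeGauge196Rethreshold

/-!
# `Balaban1983to89.B15TreeGaugeT0Var` — T. Bałaban, *Large field renormalization. I. The basic step of the 𝐑 operation*, Commun. Math. Phys. **122** (1989) 175–202 [Balaban1989LargeFieldI], p. 196: the tree `T₀` on `𝐁₀` with ONE THRESHOLD PER PAIR (*"a number a ∈ (a′₁, b′₁)"* chosen for each consecutive pair of the chain `Λ ⊃ Z″_k ⊃ ⋯`) — the chain geometry `ChainGeomV`, the gauge transformation `v(x) = V(T₀-path to x)`, and THE CORE ESTIMATE: every bond of `𝐁₀` in this gauge deviates from `1` by `≤ ((d² + 12)W² + dW)ε` for a field with `ε`-small plaquettes — PROVED by instantiating the common-threshold model of generation 5 level by level plus the re-thresholding rectangle of PART 7 (seat p26, Phase-2 continuation of row **B15.Claim@196**; PART 8a)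

statement-level skeleton of published theorems with citation tags; proofs where landed; nothing here is a claim about the Yang–Mills mass gap

PDF held: `paper:balaban1989-cmp122-large-field-i` (journal page = PDF page + 174; pp. 195–196 = PDF pp. 21–22, text layer re-read by this
seat 2026-08-21; renders read AS IMAGES by generation 2).

WHAT IS REPRODUCED (mega-formalization `lit-balaban`, HOME `run/shared/lean/pub/lit-balaban/`, Phase-2 seat p26, generation 7;
SKELETON rows **B15.Claim@196** (r12 leaf `B15.PrelimIntegrations.IneqV196`, typed p239014, no proof in print) and **B15.Def@196**).
P. 196, verbatim: *"Consider two successive rectangular parallelepipeds in the sequence … We fix the initial point y = (a₁ + 1/2, …,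
a_d + 1/2), and a number a ∈ (a′₁, b′₁). … The union of the above described tree graphs and bonds is denoted by T₀. It is a tree
graph in 𝐁₀, fixing completely a gauge in this set. … We can prove that it satisfies |V′ − 1| < O(1)M²NR_k⁴ε_k on 𝐁₀."*  Generation 5
(`B15TreeGaugeT0*`, `B15Claim196T0`) proved the claim in the single-scale chain model with ONE common threshold `a` for all pairs
(reading choice (a) of HOME/GAPS.md G-B15-p26-03; r12's `T0` with the constant sequence `fun _ ↦ τ`).  THIS FILE and its sequel
`B15Claim196T0Var` remove that choice: the thresholds `τs i` vary from pair to pair exactly as in r12's `B15TreeGraph196.T0 lo hi τs m`.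
  §1 `ChainGeomV` (every consecutive pair `(Pⁱ, Pⁱ⁺¹)` has the p. 196 geometry with ITS threshold `τs i`); the key observation
**`ChainGeomV.geom_of_le`**: the threshold of a deeper pair is admissible for every shallower pair (the intervals `[a′₁ − 1, b′₁]`
are nested along the chain), hence **`ChainGeomV.chainGeom`**: the first `j + 1` pairs form a common-threshold chain `ChainGeom lo
hi (τs j) (j + 1)` of generation 5 — so every generation-5 theorem is available LEVEL BY LEVEL.  §2 the `T₀` gauge function
`t0GaugeFnV` (`v(x) = V(T₀-path to x)`, the path to a site of layer `i` ending with the contour of threshold `τs i`) and its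
relation to the common-threshold gauge functions: on layer `i` it IS `t0GaugeFn … (τs i)`, and `t0GaugeFn … (τs i) = gᵢσᵢ(x)gᵢ⁻¹ ·
t0GaugeFn … (τs (i+1))` with the RE-THRESHOLDING RATIO `σᵢ(x) = V(Γ^{i,τs i}_x)·V(Γ^{i,τs (i+1)}_x)⁻¹` (`t0GaugeFn_rethreshold`),
which PART 7 (`B15TreeGauge196Rethreshold.norm_hol_contour_ratio_le`) bounds by `5W²ε`.  §3 **`T0HypV.norm_gauge_bond_sub_one_le`**:
for a `U1`-valued `U` with `ε`-small plaquettes on `𝐁₀`, EVERY bond `b` with both ends in `𝐁₀` has `‖U^v(b) − 1‖ ≤ ((d² + 12)W²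
+ dW)ε` (same layer: generation 5 at threshold `τs i`; adjacent layers `i, i+1`: generation 5 at the common threshold `τs (i+1)`
plus one re-thresholding factor at the end lying in layer `i`).

HONEST SCOPE / DEVIATIONS (as generation 5 except for the thresholds).  (1) SINGLE SCALE: the chain is read on ONE unit lattice (as
r12 `B15TreeGraph196` §8); in print consecutive layers live on lattices of different spacing (reading (b) of G-B15-p26-03 remains).
(2) `U1 𝔸`-valued fields (`⊇ U(N)`), `≤ ε` plaquette hypotheses on the plaquettes with four corners in `𝐁₀ = Λ∖Pᵐ`, conclusion with
the explicit constant `(d² + 12)W² + dW` (generation 5: `(d² + 7)W² + dW`; the extra `5W²` is the re-thresholding rectangle), `d = n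
+ 3 ≥ 3` needed.  Every declaration is a definition with a body or a proved theorem; nothing of [IV] is asserted as a hypothesis-free
fact beyond what is proved.  Unit `lit-balaban-p26` (literature-prover-lit-balaban-p26-g7-0).
-/

noncomputable section

open scoped BigOperators

namespace Literature.MathematicalPhysics.QuantumFieldTheory.Balaban1983to89.B15TreeGauge196

open B7Prop1Explicit B8Lemma1NonAbelian B16Ineq382

variable {n : ℕ}

/-! ## §1 The chain with one threshold per pair -/

section Chain

/-- **The chain of p. 195 with the thresholds of p. 196 chosen PER PAIR**: boxes `Pⁱ = [lo i, hi i] ⊂ ℤ^{n+3}`, `i ≤ m`, nonempty,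
every consecutive pair `(Pⁱ, Pⁱ⁺¹)` with the p. 196 geometry (`Geom`: `Pⁱ⁺¹` strictly inside `Pⁱ`) and ITS OWN threshold `τs i`
(*"a number a ∈ (a′₁, b′₁)"* for that pair) — r12's `B15TreeGraph196.Chain m lo hi τs` in the word model.
[cite: Balaban1989LargeFieldI, p.196] -/
structure ChainGeomV (lo hi : ℕ → Site (n + 3)) (τs : ℕ → ℤ) (m : ℕ) : Prop where
  geom : ∀ i, i < m → Geom (lo i) (hi i) (lo (i + 1)) (hi (i + 1)) (τs i)
  lo_le_hi : ∀ i, i ≤ m → lo i ≤ hi i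

variable {lo hi : ℕ → Site (n + 3)} {τs : ℕ → ℤ} {τ : ℤ} {m : ℕ}

/-- The common-threshold chain of generation 5 is the constant sequence. [cite: Balaban1989LargeFieldI, p.196] -/
theorem ChainGeom.chainGeomV (hC : ChainGeom lo hi τ m) : ChainGeomV lo hi (fun _ => τ) m :=
  ⟨hC.geom, hC.lo_le_hi⟩

/-- The first coordinates of the corners `yⁱ` increase along the chain. [cite: Balaban1989LargeFieldI, p.196] -/
theorem ChainGeomV.lo_i0_mono (hC : ChainGeomV lo hi τs m) {i : ℕ} :
    ∀ {k : ℕ}, i + k ≤ m → lo i i0 ≤ lo (i + k) i0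
  | 0, _ => le_rfl
  | k + 1, h => (hC.lo_i0_mono (k := k) (by omega)).trans (le_of_lt ((hC.geom (i + k) (by omega)).lo_lt i0))

/-- The first coordinates of the far corners decrease along the chain. [cite: Balaban1989LargeFieldI, p.196] -/
theorem ChainGeomV.hi_i0_anti (hC : ChainGeomV lo hi τs m) {i : ℕ} :
    ∀ {k : ℕ}, i + k ≤ m → hi (i + k) i0 ≤ hi i i0
  | 0, _ => le_rfl
  | k + 1, h => (le_of_lt ((hC.geom (i + k) (by omega)).lt_hi i0)).trans (hC.hi_i0_anti (k := k) (by omega))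

/-- **The threshold of a deeper pair is admissible for every shallower pair**: the intervals `[a′₁ − 1, b′₁]` of admissible
thresholds are nested along the chain, so `(Pⁱ, Pⁱ⁺¹)` has the p. 196 geometry with the threshold `τs j` of any `j ≥ i`.
[cite: Balaban1989LargeFieldI, p.196] -/
theorem ChainGeomV.geom_of_le (hC : ChainGeomV lo hi τs m) {i j : ℕ} (hij : i ≤ j) (hj : j < m) :
    Geom (lo i) (hi i) (lo (i + 1)) (hi (i + 1)) (τs j) where
  lo_lt := (hC.geom i (by omega)).lo_lt
  lt_hi := (hC.geom i (by omega)).lt_hi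
  le_tau := by
    obtain ⟨k, rfl⟩ := Nat.exists_eq_add_of_le hij
    have h1 := hC.lo_i0_mono (i := i + 1) (k := k) (by omega)
    have h2 := (hC.geom (i + k) hj).le_tau
    rw [show i + 1 + k = i + k + 1 by omega] at h1
    omega
  tau_le := by
    obtain ⟨k, rfl⟩ := Nat.exists_eq_add_of_le hij
    have h1 := hC.hi_i0_anti (i := i + 1) (k := k) (by omega)
    have h2 := (hC.geom (i + k) hj).tau_le
    rw [show i + 1 + k = i + k + 1 by omega] at h1
    omega

/-- **Level by level, the chain is a common-threshold chain of generation 5**: the first `j + 1` pairs with the threshold `τs j`.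
[cite: Balaban1989LargeFieldI, p.196] -/
theorem ChainGeomV.chainGeom (hC : ChainGeomV lo hi τs m) {j : ℕ} (hj : j < m) : ChainGeom lo hi (τs j) (j + 1) :=
  ⟨fun i hi => hC.geom_of_le (Nat.lt_succ_iff.mp hi) hj, fun i hi => hC.lo_le_hi i (by omega)⟩

/-- In particular the whole chain is a common-threshold chain for its deepest threshold (the GAUGE below is nevertheless the
one with the varying thresholds). [cite: Balaban1989LargeFieldI, p.196] -/
theorem ChainGeomV.chainGeom_last (hC : ChainGeomV lo hi τs (m + 1)) : ChainGeom lo hi (τs m) (m + 1) :=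
  hC.chainGeom (Nat.lt_succ_self m)

/-- `𝐁₀` grows with the number of layers. [cite: Balaban1989LargeFieldI, p.196] -/
theorem B0_mono {k m : ℕ} (h : k ≤ m) : B0 lo hi k ⊆ B0 lo hi m := fun _ ⟨i, hi, hz⟩ => ⟨i, lt_of_lt_of_le hi h, hz⟩

/-- The level of a site of the `i`-th layer is `i`. [cite: Balaban1989LargeFieldI, p.196] -/
theorem ChainGeomV.lvl_eq (hC : ChainGeomV lo hi τs m) {i : ℕ} (him : i < m) {x : Site (n + 3)} (hx : x ∈ layer lo hi i) :
    lvl lo hi x = i :=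
  (hC.chainGeom him).lvl_eq (Nat.lt_succ_self i) hx

/-- `𝐁₀ = Λ ∖ Pᵐ`. [cite: Balaban1989LargeFieldI, p.196] -/
theorem ChainGeomV.mem_B0_iff (hC : ChainGeomV lo hi τs m) {x : Site (n + 3)} :
    x ∈ B0 lo hi m ↔ x ∈ box (lo 0) (hi 0) ∧ x ∉ box (lo m) (hi m) := by
  cases m with
  | zero => exact ⟨fun ⟨_, h, _⟩ => absurd h (Nat.not_lt_zero _), fun ⟨h0, hm⟩ => absurd h0 hm⟩
  | succ k => exact hC.chainGeom_last.mem_B0_iff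

/-- Unit bonds join equal or adjacent layers. [cite: Balaban1989LargeFieldI, p.196] -/
theorem ChainGeomV.level_le_succ (hC : ChainGeomV lo hi τs m) {i j : ℕ} (him : i < m) (hj : j < m) {x x' : Site (n + 3)}
    (hx : x ∈ layer lo hi i) (hx' : x' ∈ layer lo hi j) (hclose : ∀ κ, x κ - 1 ≤ x' κ ∧ x' κ ≤ x κ + 1) : j ≤ i + 1 :=
  (hC.chainGeom (j := max i j) (by omega)).level_le_succ (by omega) (by omega) hx hx' hclose

end Chain

/-! ## §2 The gauge transformation of `T₀` with one threshold per pair -/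

section Gauge

variable {lo hi : ℕ → Site (n + 3)} {τs : ℕ → ℤ} {m : ℕ} {G : Type*} [Group G]

/-- **The gauge transformation of the tree `T₀` with the thresholds chosen per pair**: `v(x) = V(T₀-path from y⁰ to x)`, the
path to a site `x` of layer `i` being the chain word to `yⁱ` followed by the contour `Γ^{i}_{yⁱ,x}` OF THRESHOLD `τs i`
(`t0word lo hi (τs i) i x`). [cite: Balaban1989LargeFieldI, p.196] -/
def t0GaugeFnV (V : Site (n + 3) → Fin (n + 3) → G) (lo hi : ℕ → Site (n + 3)) (τs : ℕ → ℤ) (x : Site (n + 3)) : G :=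
  t0GaugeFn V lo hi (τs (lvl lo hi x)) x

/-- On the `i`-th layer the gauge function is generation 5's gauge function of threshold `τs i`. [cite: Balaban1989LargeFieldI, p.196] -/
theorem ChainGeomV.t0GaugeFnV_eq (hC : ChainGeomV lo hi τs m) (V : Site (n + 3) → Fin (n + 3) → G) {i : ℕ} (him : i < m)
    {x : Site (n + 3)} (hx : x ∈ layer lo hi i) : t0GaugeFnV V lo hi τs x = t0GaugeFn V lo hi (τs i) x := by
  rw [t0GaugeFnV, hC.lvl_eq him hx]

/-- … i.e. the transport along `t0word lo hi (τs i) i x`. [cite: Balaban1989LargeFieldI, p.196] -/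
theorem ChainGeomV.t0GaugeFnV_eq_hol (hC : ChainGeomV lo hi τs m) (V : Site (n + 3) → Fin (n + 3) → G) {i : ℕ} (him : i < m)
    {x : Site (n + 3)} (hx : x ∈ layer lo hi i) : t0GaugeFnV V lo hi τs x = hol V (lo 0) (t0word lo hi (τs i) i x) := by
  rw [hC.t0GaugeFnV_eq V him hx, (hC.chainGeom him).t0GaugeFn_eq V (Nat.lt_succ_self i) hx]

/-- **Re-thresholding the gauge function on layer `i`**: `t0GaugeFn … (τs i) x = (gᵢ σᵢ(x) gᵢ⁻¹) · t0GaugeFn … (τs (i+1)) x` with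
`gᵢ = V(chainWord i)` and the ratio `σᵢ(x) = V(Γ^{i,τs i}_{yⁱ,x}) · V(Γ^{i,τs (i+1)}_{yⁱ,x})⁻¹` of the two contours of `x` in the pair
`(Pⁱ, Pⁱ⁺¹)` (both thresholds admissible there, `geom_of_le`). [cite: Balaban1989LargeFieldI, p.196] -/
theorem ChainGeomV.t0GaugeFn_rethreshold (hC : ChainGeomV lo hi τs m) (V : Site (n + 3) → Fin (n + 3) → G) {i : ℕ}
    (him : i + 1 < m) {x : Site (n + 3)} (hx : x ∈ layer lo hi i) :
    t0GaugeFn V lo hi (τs i) x =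
      hol V (lo 0) (chainWord lo i) *
        (hol V (lo i) (contour (lo i) (hi i) (τs i) x) * (hol V (lo i) (contour (lo i) (hi i) (τs (i + 1)) x))⁻¹) *
        (hol V (lo 0) (chainWord lo i))⁻¹ * t0GaugeFn V lo hi (τs (i + 1)) x := by
  rw [(hC.chainGeom (by omega : i < m)).t0GaugeFn_eq_mul V (Nat.lt_succ_self i) hx,
    (hC.chainGeom him).t0GaugeFn_eq_mul V (by omega : i < i + 1 + 1) hx]
  simp only [treeGaugeFn]
  group

/-- Two gauge functions agreeing at `x + e_μ` and differing by a left constant at `x`. [cite: Balaban1985Averaging, (8) p.18] -/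
theorem gaugeAct_eq_mul_of_eq {v w : Site (n + 3) → G} {c : G} (V : Site (n + 3) → Fin (n + 3) → G) {x : Site (n + 3)}
    {μ : Fin (n + 3)} (hx : w x = c * v x) (hx' : w (x + e μ) = v (x + e μ)) :
    gaugeAct w V x μ = c * gaugeAct v V x μ := by
  simp only [gaugeAct, hx, hx']; group

/-- Two gauge functions agreeing at `x` and differing by a left constant at `x + e_μ`. [cite: Balaban1985Averaging, (8) p.18] -/
theorem gaugeAct_eq_mul_inv_of_eq {v w : Site (n + 3) → G} {c : G} (V : Site (n + 3) → Fin (n + 3) → G) {x : Site (n + 3)}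
    {μ : Fin (n + 3)} (hx : w x = v x) (hx' : w (x + e μ) = c * v (x + e μ)) :
    gaugeAct w V x μ = gaugeAct v V x μ * c⁻¹ := by
  simp only [gaugeAct, hx, hx']; group

end Gauge

/-! ## §3 A field with small plaquettes on `𝐁₀` in the `T₀` gauge: every bond of `𝐁₀` -/

section Core

variable {𝔸 : Type*} [NormedRing 𝔸] [NormOneClass 𝔸]

/-- Generation 5's `T0Hyp` with one threshold per pair: the chain geometry `ChainGeomV`, sides of `Λ` of at most `W + 1` sites
(condition (i) of p. 177), a `U1`-valued bond field `U` whose plaquettes with corners in `𝐁₀` deviate from `1` by at most `ε`.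
[cite: Balaban1989LargeFieldI, p.196 (bound on V′)] -/
structure T0HypV (lo hi : ℕ → Site (n + 3)) (τs : ℕ → ℤ) (m W : ℕ) (U : Site (n + 3) → Fin (n + 3) → 𝔸ˣ) (ε : ℝ) :
    Prop where
  chain : ChainGeomV lo hi τs m
  width : ∀ κ, hi 0 κ - lo 0 κ ≤ W
  unit : ∀ x κ, U x κ ∈ U1 𝔸
  eps_nonneg : 0 ≤ ε
  plaq : B16Ineq382.PlaqSmallOn (B0 lo hi m) U ε

variable {lo hi : ℕ → Site (n + 3)} {τs : ℕ → ℤ} {m W : ℕ} {U : Site (n + 3) → Fin (n + 3) → 𝔸ˣ} {ε : ℝ}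

/-- **Generation 5's hypotheses, level by level**: the first `j + 1` pairs with the common threshold `τs j`. [cite: Balaban1989LargeFieldI, p.196 (bound on V′)] -/
theorem T0HypV.t0Hyp (H : T0HypV lo hi τs m W U ε) {j : ℕ} (hj : j < m) : T0Hyp lo hi (τs j) (j + 1) W U ε :=
  ⟨H.chain.chainGeom hj, H.width, H.unit, H.eps_nonneg, H.plaq.mono (B0_mono hj)⟩

/-- **Bonds inside one layer**: `‖U^v(b) − 1‖ ≤ (5W² + dW)ε` — generation 5 at the threshold `τs i`. [cite: Balaban1989LargeFieldI, p.196 (bound on V′)] -/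
theorem T0HypV.norm_sameLevel (H : T0HypV lo hi τs m W U ε) {i : ℕ} (him : i < m) {x : Site (n + 3)} {μ : Fin (n + 3)}
    (hx : x ∈ layer lo hi i) (hx' : x + e μ ∈ layer lo hi i) :
    ‖((gaugeAct (t0GaugeFnV U lo hi τs) U x μ : 𝔸ˣ) : 𝔸) - 1‖ ≤ (5 * (W : ℝ) ^ 2 + (n + 3) * W) * ε := by
  have hid : gaugeAct (t0GaugeFnV U lo hi τs) U x μ = gaugeAct (t0GaugeFn U lo hi (τs i)) U x μ := by
    simp only [gaugeAct, H.chain.t0GaugeFnV_eq U him hx, H.chain.t0GaugeFnV_eq U him hx']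
  rw [hid]
  exact (H.t0Hyp him).norm_sameLevel (Nat.lt_succ_self i) hx hx'

/-- **The re-thresholding ratio is small**: `‖σᵢ(x) − 1‖ ≤ 5W²ε` for `x` in layer `i` (PART 7 on the pair `(Pⁱ, Pⁱ⁺¹)` with the
two admissible thresholds `τs i`, `τs (i+1)`). [cite: Balaban1989LargeFieldI, p.196 (bound on V′)] -/
theorem T0HypV.norm_rethreshold_le (H : T0HypV lo hi τs m W U ε) {i : ℕ} (him : i + 1 < m) {x : Site (n + 3)}
    (hx : x ∈ layer lo hi i) :
    ‖((hol U (lo i) (contour (lo i) (hi i) (τs i) x) * (hol U (lo i) (contour (lo i) (hi i) (τs (i + 1)) x))⁻¹ : 𝔸ˣ) : 𝔸)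
      - 1‖ ≤ 5 * (W : ℝ) ^ 2 * ε :=
  norm_hol_contour_ratio_le (H.chain.geom i (by omega)) (H.chain.geom_of_le (Nat.le_succ i) him)
    (fun κ => (H.chain.chainGeom (by omega : i < m)).width_le H.width (Nat.le_succ i) κ) H.unit H.eps_nonneg
    (H.plaq.mono (layer_subset_B0 (by omega : i < m))) hx

/-- **Bonds from layer `i` to layer `i+1`**: `‖U^v(b) − 1‖ ≤ ((d² + 12)W² + dW)ε` — generation 5's two-level estimate at the common
threshold `τs (i+1)` (admissible for both pairs), after re-thresholding the gauge function at the end `x ∈ Pⁱ∖Pⁱ⁺¹`: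
`U^v(b) = (gᵢσᵢ(x)gᵢ⁻¹) · U^{v[τs (i+1)]}(b)`. [cite: Balaban1989LargeFieldI, p.196 (bound on V′)] -/
theorem T0HypV.norm_levelUp (H : T0HypV lo hi τs m W U ε) {i : ℕ} (him : i + 1 < m) {x : Site (n + 3)} {μ : Fin (n + 3)}
    (hx : x ∈ layer lo hi i) (hx' : x + e μ ∈ layer lo hi (i + 1)) :
    ‖((gaugeAct (t0GaugeFnV U lo hi τs) U x μ : 𝔸ˣ) : 𝔸) - 1‖ ≤
      ((((n : ℝ) + 3) ^ 2 + 12) * (W : ℝ) ^ 2 + (n + 3) * W) * ε := by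
  set g := hol U (lo 0) (chainWord lo i) with hg
  set σ := hol U (lo i) (contour (lo i) (hi i) (τs i) x) * (hol U (lo i) (contour (lo i) (hi i) (τs (i + 1)) x))⁻¹ with hσ
  have h1 : t0GaugeFnV U lo hi τs x = g * σ * g⁻¹ * t0GaugeFn U lo hi (τs (i + 1)) x := by
    rw [H.chain.t0GaugeFnV_eq U (by omega) hx, H.chain.t0GaugeFn_rethreshold U him hx]
  have h2 : t0GaugeFnV U lo hi τs (x + e μ) = t0GaugeFn U lo hi (τs (i + 1)) (x + e μ) := H.chain.t0GaugeFnV_eq U him hx'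
  rw [gaugeAct_eq_mul_of_eq U h1 h2]
  have hgU : g ∈ U1 𝔸 := hol_mem H.unit _ _
  have hσU : σ ∈ U1 𝔸 := (U1 𝔸).mul_mem (hol_mem H.unit _ _) ((U1 𝔸).inv_mem (hol_mem H.unit _ _))
  have hcU : g * σ * g⁻¹ ∈ U1 𝔸 := (U1 𝔸).mul_mem ((U1 𝔸).mul_mem hgU hσU) ((U1 𝔸).inv_mem hgU)
  have hA := (H.t0Hyp him).norm_levelUp (by omega : i + 1 < i + 1 + 1) hx hx'
  have hB : ‖((g * σ * g⁻¹ : 𝔸ˣ) : 𝔸) - 1‖ ≤ 5 * (W : ℝ) ^ 2 * ε := by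
    rw [Units.val_mul, Units.val_mul]
    exact (norm_units_conj_sub_one_le hgU _).trans (H.norm_rethreshold_le him hx)
  refine (norm_units_mul_sub_one_le hcU).trans ?_
  have hsum : 5 * (W : ℝ) ^ 2 * ε + ((((n : ℝ) + 3) ^ 2 + 7) * (W : ℝ) ^ 2 + (n + 3) * W) * ε =
      ((((n : ℝ) + 3) ^ 2 + 12) * (W : ℝ) ^ 2 + (n + 3) * W) * ε := by ring
  linarith

/-- **Bonds from layer `i+1` to layer `i`**: the same bound — `U^v(b) = U^{v[τs (i+1)]}(b) · (gᵢσᵢ(x + e_μ)gᵢ⁻¹)⁻¹`.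
[cite: Balaban1989LargeFieldI, p.196 (bound on V′)] -/
theorem T0HypV.norm_levelDown (H : T0HypV lo hi τs m W U ε) {i : ℕ} (him : i + 1 < m) {x : Site (n + 3)} {μ : Fin (n + 3)}
    (hx : x ∈ layer lo hi (i + 1)) (hx' : x + e μ ∈ layer lo hi i) :
    ‖((gaugeAct (t0GaugeFnV U lo hi τs) U x μ : 𝔸ˣ) : 𝔸) - 1‖ ≤
      ((((n : ℝ) + 3) ^ 2 + 12) * (W : ℝ) ^ 2 + (n + 3) * W) * ε := by
  set g := hol U (lo 0) (chainWord lo i) with hg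
  set σ := hol U (lo i) (contour (lo i) (hi i) (τs i) (x + e μ)) *
    (hol U (lo i) (contour (lo i) (hi i) (τs (i + 1)) (x + e μ)))⁻¹ with hσ
  have h1 : t0GaugeFnV U lo hi τs x = t0GaugeFn U lo hi (τs (i + 1)) x := H.chain.t0GaugeFnV_eq U him hx
  have h2 : t0GaugeFnV U lo hi τs (x + e μ) = g * σ * g⁻¹ * t0GaugeFn U lo hi (τs (i + 1)) (x + e μ) := by
    rw [H.chain.t0GaugeFnV_eq U (by omega) hx', H.chain.t0GaugeFn_rethreshold U him hx']
  rw [gaugeAct_eq_mul_inv_of_eq U h1 h2]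
  have hgU : g ∈ U1 𝔸 := hol_mem H.unit _ _
  have hσU : σ ∈ U1 𝔸 := (U1 𝔸).mul_mem (hol_mem H.unit _ _) ((U1 𝔸).inv_mem (hol_mem H.unit _ _))
  have hcU : g * σ * g⁻¹ ∈ U1 𝔸 := (U1 𝔸).mul_mem ((U1 𝔸).mul_mem hgU hσU) ((U1 𝔸).inv_mem hgU)
  have hAU : gaugeAct (t0GaugeFn U lo hi (τs (i + 1))) U x μ ∈ U1 𝔸 :=
    gaugeAct_mem H.unit (fun _ => hol_mem H.unit _ _) x μ
  have hA := (H.t0Hyp him).norm_levelDown (by omega : i + 1 < i + 1 + 1) hx hx'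
  have hB : ‖(((g * σ * g⁻¹)⁻¹ : 𝔸ˣ) : 𝔸) - 1‖ ≤ 5 * (W : ℝ) ^ 2 * ε := by
    refine (norm_inv_sub_one_le hcU).trans ?_
    rw [Units.val_mul, Units.val_mul]
    exact (norm_units_conj_sub_one_le hgU _).trans (H.norm_rethreshold_le him hx')
  refine (norm_units_mul_sub_one_le hAU).trans ?_
  have hsum : ((((n : ℝ) + 3) ^ 2 + 7) * (W : ℝ) ^ 2 + (n + 3) * W) * ε + 5 * (W : ℝ) ^ 2 * ε =
      ((((n : ℝ) + 3) ^ 2 + 12) * (W : ℝ) ^ 2 + (n + 3) * W) * ε := by ring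
  linarith

/-- **THE CORE ESTIMATE: every bond of `𝐁₀` in the `T₀` gauge with one threshold per pair.**  For a `U1`-valued `U` with
`ε`-small plaquettes on `𝐁₀` and the `T₀` gauge transformation `v(x) = U(T₀-path to x)`, every bond `b = ⟨x, x + e_μ⟩` with `x ∈
Pⁱ∖Pⁱ⁺¹`, `x + e_μ ∈ Pʲ∖Pʲ⁺¹` (`i, j < m`) has `‖U^v(b) − 1‖ ≤ ((d² + 12)W² + dW)·ε`. [cite: Balaban1989LargeFieldI, p.196 (bound on V′)] -/
theorem T0HypV.norm_gauge_bond_sub_one_le (H : T0HypV lo hi τs m W U ε) {i j : ℕ} (him : i < m) (hjm : j < m)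
    {x : Site (n + 3)} {μ : Fin (n + 3)} (hx : x ∈ layer lo hi i) (hx' : x + e μ ∈ layer lo hi j) :
    ‖((gaugeAct (t0GaugeFnV U lo hi τs) U x μ : 𝔸ˣ) : 𝔸) - 1‖ ≤
      ((((n : ℝ) + 3) ^ 2 + 12) * (W : ℝ) ^ 2 + (n + 3) * W) * ε := by
  have hε := H.eps_nonneg
  have hclose : ∀ κ, x κ - 1 ≤ (x + e μ) κ ∧ (x + e μ) κ ≤ x κ + 1 := fun κ => by
    simp only [Pi.add_apply, e_apply]; split_ifs <;> constructor <;> omega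
  have hclose' : ∀ κ, (x + e μ) κ - 1 ≤ x κ ∧ x κ ≤ (x + e μ) κ + 1 := fun κ => by
    simp only [Pi.add_apply, e_apply]; split_ifs <;> constructor <;> omega
  have hji : j ≤ i + 1 := H.chain.level_le_succ him hjm hx hx' hclose
  have hij : i ≤ j + 1 := H.chain.level_le_succ hjm him hx' hx hclose'
  have hmono : (5 * (W : ℝ) ^ 2 + (n + 3) * W) * ε ≤ ((((n : ℝ) + 3) ^ 2 + 12) * (W : ℝ) ^ 2 + (n + 3) * W) * ε := by
    apply mul_le_mul_of_nonneg_right _ hε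
    nlinarith [sq_nonneg (W : ℝ), sq_nonneg ((n : ℝ) + 3)]
  rcases Nat.lt_trichotomy j i with hlt | rfl | hgt
  · obtain rfl : i = j + 1 := by omega
    exact H.norm_levelDown him hx hx'
  · exact (H.norm_sameLevel him hx hx').trans hmono
  · obtain rfl : j = i + 1 := by omega
    exact H.norm_levelUp hjm hx hx'

/-- The core estimate for two sites of `𝐁₀`. [cite: Balaban1989LargeFieldI, p.196 (bound on V′)] -/
theorem T0HypV.norm_gauge_bond_sub_one_le_B0 (H : T0HypV lo hi τs m W U ε) {x : Site (n + 3)} {μ : Fin (n + 3)}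
    (hx : x ∈ B0 lo hi m) (hx' : x + e μ ∈ B0 lo hi m) :
    ‖((gaugeAct (t0GaugeFnV U lo hi τs) U x μ : 𝔸ˣ) : 𝔸) - 1‖ ≤
      ((((n : ℝ) + 3) ^ 2 + 12) * (W : ℝ) ^ 2 + (n + 3) * W) * ε := by
  obtain ⟨i, him, hxi⟩ := hx
  obtain ⟨j, hjm, hxj⟩ := hx'
  exact H.norm_gauge_bond_sub_one_le him hjm hxi hxj

end Core

end Literature.MathematicalPhysics.QuantumFieldTheory.Balaban1983to89.B15TreeGauge196
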